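import Summits.Ventures.PackingBounds.ThreePointCert.G27CertB

/-!
# A(10, arccos 1/10) ≤ 26: kernel instance of the exact value-27 three-point certificate — the certificate records

Framing: lottery ticket; floor = certified bounds/negative ranges. Venture `PackingBounds` (cell
`pub-packcert`), recognition seat (T5: the ghost `srg(27, 20, 29/2, 15)`), three-point SDP family's exact
kernel format. Integer data of an EXACT (slack-free) Bachoc–Vallentin certificate of value exactly `27` for
`A(10, arccos 1/10)` (n = 10, s = 1/10, degree 6, symmetric sums of squares of Machado–de Oliveira Filho
type, `B = 0`; every block on the optimal face complementary to the ghost pseudo-configuration), produced by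
`pub-packcert-recog` gen 16 (`code/t5/kernel/job3.py` + `job4b.py`, the latter = `pub-packcert-lp` gen 4's
`job4.py` adapted) in the units of the kernel checker `ThreePointCert.CheckExact` (soundness
`ThreePointCert.SoundExact*`, built by `pub-packcert-lp` gen 4 for `A(9, arccos 1/3) ≤ 98`). Generated file:
plain lists of integers / monomials.
-/

namespace Summit.Ventures.PackingBounds.ThreePointCert.G27

open Literature.Geometry.DiscreteGeometry Literature.Geometry.DiscreteGeometry.PolyCert PolyCert.SPoly

/-- The parts of the multiplier-0 sum of squares. -/
def parts0 : List SymPart := [pR0trv, pR0alt, pR0std]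

/-- The parts of the multiplier-1 sum of squares. -/
def parts1 : List SymPart := [pR1trv, pR1alt, pR1std]

/-- The parts of the multiplier-2 sum of squares. -/
def parts2 : List SymPart := [pR2trv, pR2alt, pR2std]

/-- The parts of the multiplier-3 sum of squares. -/
def parts3 : List SymPart := [pR3trv, pR3alt, pR3std]

/-- The parts of the multiplier-4 sum of squares. -/
def parts4 : List SymPart := [pR4trv, pR4alt, pR4std]

/-- The three-point blocks. -/
def fblocks : List FBlkX := [fb0, fb1, fb2, fb3, fb4]

/-- The exact certificate. -/
def cert : CertX :=
  ⟨10, 6, 1, 10, 414253550060899129164866685477929484472161498980966989824000000000000, 27, eA, fblocks, parts0, parts1, parts2, parts3, parts4,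
   5, [1121984607744, 4674745995884780175360000000000000, 467474599588478017536000000000000, 46747459958847801753600000000000, 46747459958847801753600000000000000], 1, ewP, ehP, 1329227995784915872903807060280344576, 11787210080144064760075406244554898771820593781063359160157608363785376440194394417175443357175619279388672⟩

/-- The claimed expansions. -/
def polys : PolysX := ⟨eFP, [eTOT0, eTOT1, eTOT2, eTOT3, eTOT4], eEH0, eEH1⟩

/-- Gram block of the positivity certificate of `h` (multiplier 1). -/
def gh0 : GramBlk := ⟨(List.range 6).map fun i => ⟨i, 0, 0⟩, gh0L⟩

/-- Gram block of the positivity certificate of `h` (multiplier `g_q`). -/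
def gh1 : GramBlk := ⟨(List.range 5).map fun i => ⟨i, 0, 0⟩, gh1L⟩

end Summit.Ventures.PackingBounds.ThreePointCert.G27
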